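import Literature.NumberTheory.GaloisRepresentations.ModPGaloisRep
import HarnessLib

/-!
# Discharge of `toZMod_cyclotomicCharacter_eq` (mod `p` vs. `p`-adic cyclotomic character)

D-0014 keeps `Literature/` sorry-free by stating cited results as named facts `def X : Prop`.
This sibling file of `Literature.NumberTheory.GaloisRepresentations.ModPGaloisRep` proves the fact

* `Literature.NumberTheory.GaloisRepresentations.toZMod_cyclotomicCharacter_eq_holds` —
  compatibility `χ̄_p = ι ∘ (χ_p mod p)` of the mod `p` cyclotomic character
  `modPCyclotomicCharacter K k p ι : Γ_K →ₜ* kˣ` (built from Mathlib's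
  `modularCyclotomicCharacter` on `K̄`) with the `p`-adic cyclotomic character
  `GaloisRep.cyclotomicCharacter K p : Γ_K →ₜ* ℤ_[p]ˣ` (built from Mathlib's
  `cyclotomicCharacter`), for every `ι : ZMod p →+* k` and `σ ∈ Γ_K` (`p ≠ char K`),

as `theorem X_holds : X` (users holding `(h : X)` are fed `X_holds`), together with

* `Literature.NumberTheory.GaloisRepresentations.toZMod_cyclotomicCharacter_apply` — the same
  statement with values in `ZMod p`: `PadicInt.toZMod (χ_p σ) = modPCyclotomicCharacterZMod K p σ`;
* `Literature.NumberTheory.GaloisRepresentations.PadicInt.val_toZModPow_one_eq_val_toZMod` —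
  `x mod p` computed through `PadicInt.toZModPow 1` and through `PadicInt.toZMod` have the same
  representative in `ℕ`.

## Proof

Both characters are pinned down by the same defining property `σ ζ = ζ ^ {χ(σ)}` on `μ_p(K̄)`:
by `modularCyclotomicCharacter.unique` it suffices to check `σ t = t ^ (χ_p(σ) mod p)` for all
`t ∈ μ_p(K̄)`, which is Mathlib's `cyclotomicCharacter.spec` at level `p ^ 1` (the tree's
`GaloisRep.cyclotomicCharacter_spec`), once `(toZModPow 1 x).val = (toZMod x).val` is known; the
latter holds because both sides are the unique representative `< p` of `x` modulo the maximal
ideal (`PadicInt.zmodRepr_unique`, `PadicInt.appr_spec`).  No new named fact is introduced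
(D-0026).

## References

* J.-P. Serre, *Sur les représentations modulaires de degré 2 de `Gal(ℚ̄/ℚ)`*, Duke Math. J. 54
  (1987), 179–230, §1.4 (the cyclotomic character `χ : G_ℚ → 𝔽_p^*`). [Serre1987]
* B. Edixhoven, *Serre's conjecture*, in: Cornell–Silverman–Stevens (eds.), *Modular Forms and
  Fermat's Last Theorem*, Springer (1997), 209–242, §1 (PDF p. 272: `χ_n : G_ℚ → (ℤ/nℤ)^*` is the
  character with `σ(x) = x^{χ_n(σ)}` for all `x ∈ ℚ̄`, `x ^ n = 1`). [Edixhoven1997]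
* J.-P. Serre, *Abelian ℓ-adic representations and elliptic curves* (1968), Ch. I §1.2.
  [SerreAbelianLadic1968]
-/

noncomputable section

open Field

namespace Literature.NumberTheory.GaloisRepresentations

universe u v

/-- `x mod p` computed by `PadicInt.toZModPow 1 : ℤ_[p] → ℤ/p¹` and by
`PadicInt.toZMod : ℤ_[p] → ℤ/p` have the same canonical representative: `zmodRepr x = appr x 1`,
both being `< p` and congruent to `x` modulo the maximal ideal (`PadicInt.zmodRepr_unique`).
[folklore] -/
theorem PadicInt.val_toZModPow_one_eq_val_toZMod {p : ℕ} [Fact p.Prime] (x : ℤ_[p]) :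
    (PadicInt.toZModPow 1 x).val = (PadicInt.toZMod x).val := by
  have happr : x.zmodRepr = x.appr 1 :=
    PadicInt.zmodRepr_unique x _ (by simpa using PadicInt.appr_lt x 1)
      (by
        rw [PadicInt.maximalIdeal_eq_span_p, ← pow_one (p : ℤ_[p])]
        exact PadicInt.appr_spec 1 x)
  rw [PadicInt.val_toZMod_eq_zmodRepr, happr]
  show ((x.appr 1 : ℕ) : ZMod (p ^ 1)).val = x.appr 1
  rw [ZMod.val_natCast, Nat.mod_eq_of_lt (PadicInt.appr_lt x 1)]

variable (K : Type u) [Field K] (k : Type v) [Field k] [TopologicalSpace k] [IsTopologicalRing k]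
  (p : ℕ) [Fact p.Prime] [NeZero (p : K)]

/-- **The mod `p` cyclotomic character is the reduction of the `p`-adic one** (values in
`ZMod p`): `χ_p(σ) mod p = χ̄_p(σ)` for every `σ ∈ Γ_K` (`p ≠ char K`), where
`χ̄_p = modPCyclotomicCharacterZMod K p` and `χ_p = GaloisRep.cyclotomicCharacter K p`.  By
`modularCyclotomicCharacter.unique` it suffices that `σ t = t ^ (χ_p(σ) mod p)` for all
`t ∈ μ_p(K̄)`: this is `GaloisRep.cyclotomicCharacter_spec` (Mathlib `cyclotomicCharacter.spec`)
at level `p ^ 1`, with `PadicInt.val_toZModPow_one_eq_val_toZMod`.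
Ref: Serre, Duke Math. J. 54 (1987), §1.4; Edixhoven (1997), §1, PDF p. 272 (definition of `χ_n`
by `σ(x) = x^{χ_n(σ)}`, `x ^ n = 1`). [cite: Serre1987, §1.4] [cite: Edixhoven1997, §1, PDF p. 272] -/
theorem toZMod_cyclotomicCharacter_apply (σ : absoluteGaloisGroup K) :
    PadicInt.toZMod ((GaloisRep.cyclotomicCharacter K p σ : ℤ_[p]ˣ) : ℤ_[p]) =
      (modPCyclotomicCharacterZMod K p σ : ZMod p) := by
  refine modularCyclotomicCharacter.unique (AlgebraicClosure K)
    (HasEnoughRootsOfUnity.natCard_rootsOfUnity (AlgebraicClosure K) p) _ fun t ht => ?_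
  have ht' : ((t : (AlgebraicClosure K)ˣ) : AlgebraicClosure K) ^ p ^ 1 = 1 := by
    rw [pow_one]
    exact (mem_rootsOfUnity' p t).mp ht
  have h := GaloisRep.cyclotomicCharacter_spec K p σ (t : AlgebraicClosure K) ht'
  rwa [PadicInt.val_toZModPow_one_eq_val_toZMod] at h

/-- **Discharge of `toZMod_cyclotomicCharacter_eq`** (compatibility of the mod `p` cyclotomic
character with the `p`-adic cyclotomic character of item C6): for every `ι : ZMod p →+* k` and
`σ ∈ Γ_K`, `ι (χ_p(σ) mod p) = χ̄_p(σ)` in `k`.  Immediate from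
`toZMod_cyclotomicCharacter_apply` and the unfolding lemma `coe_modPCyclotomicCharacter_apply`.
Ref: Serre, Duke Math. J. 54 (1987), §1.4 ("le caractère cyclotomique" `χ : G_ℚ → 𝔽_p^*`);
Serre, *Abelian ℓ-adic representations* (1968), Ch. I §1.2; Edixhoven (1997), §1, PDF p. 272.
[cite: Serre1987, §1.4] [cite: Edixhoven1997, §1, PDF p. 272] -/
theorem toZMod_cyclotomicCharacter_eq_holds : toZMod_cyclotomicCharacter_eq K k p := by
  intro ι σ
  rw [coe_modPCyclotomicCharacter_apply, toZMod_cyclotomicCharacter_apply]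

end Literature.NumberTheory.GaloisRepresentations
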